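import Summits.QuantumFields.BalabanUV.T4Continuum.Support.NE3CoarseTorusExact
import HarnessLib

/-!
# T⁴ programme, node NE3 — BLOCK-POINCARÉ ON THE k-FOLD FLAT TANGENT SPACE (row E-MLw-w3), THE CORE (complex values):
# `Σ‖Y‖² ≤ (5 + 4d·Λ)·L^{2k}·Σ‖∂Y‖²` from `Σ‖S‖² ≤ Λ·Σ‖div S‖²` for the straight k-block average `S`; `Λ = N²∕2` on
# `ker (Tcoarse L)^[k]` (k-free, N-dependent), `Λ = 0` on `ker (Qcoarse L)^[k]` (N-free)

NE3 formalisation swarm `b2b-balaban-t4-ne3-formalise-*`, LEAF PROVER 04 (gen 4), row **E-MLw-w3** of `t4/formal/NE3/LEAVES.md`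
(typer v1.44∕v1.45; owner skeleton `t4/skeletons/NE3-t4-ne3-p1.md` v1.9 §4b, sub-leaf (w3) of the socket E-ML_w
`NE3EnergyWeightedShapes.WeightedTangentCoercive`), file (C2a) of the SHAPE note `t4/formal/NE3/Statements/E-MLw-w3-SHAPE-v1.md`;
on (A) `NE3TangentFlatStructure` (frames coarse-exact), (B) `NE3BlockLineAverage` (tiling + gradient-currency estimates), (C1)
`NE3CoarseTorusExact` (block∕torus Poincaré, exact periodic 1-forms bounded by their divergence).  The matrix∕operator-norm reading
(the socket's currency) is file (C2b) `NE3BlockPoincareTangent`.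

THE ARGUMENT (one screen).  `M = L^k`, torus `periodBox (M·N)`, blocks `M•z + [0,M)^d`, `z ∈ periodBox N`.  Per block and component:
`Σ_v ‖Y(q+v,κ)‖² ≤ 2Σ_v‖Y − mean‖² + 2M^d‖mean‖²`; the oscillation is `≤ (M²∕2)·Σ_v Σ_μ‖∂_μY_κ‖²` ((C1), `d`-free); the mean is the
LINE mean up to `M·Σ‖∂_κY_κ‖` along the segment ((B)); the line mean IS the k-fold straight average `(Qcoarse L)^[k] Y` ((B) tiling),
which for a tangent direction is COARSE-EXACT ((A)) and hence bounded by its coarse divergence times `N²∕2` ((C1)), and the coarse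
divergence of the line mean telescopes to block sums of `∂_κY_κ` ((B)).  Summing over the blocks with the periodic shift invariance
of the torus sums gives the constant `5 + 4d·Λ` from the abstract input `Σ‖S‖² ≤ Λ·Σ‖div S‖²` (`Λ = N²∕2` tangent, `Λ = 0` straight kernel).

CONTENT (all [folklore]; 0 sorry; 0 def):
§1 bookkeeping (`norm_sq_le_two_mul`, `sum_norm_sq_le_of_mean`, `norm_sum_sq_le_card_mul`, reorderings `sum_rotate3∕4(′)`, periodic
   block∕shift sums `sum_blocks_torus(_shift)`);
§2 **`sum_norm_sq_le_of_lineMean_bound`** — the CORE: `(L^k·N)`-periodic complex `Y` and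
   `Σ_{z,κ}‖(Qcoarse L)^[k] Y z κ‖² ≤ Λ·Σ_z‖Σ_κ((Qcoarse L)^[k] Y z κ − (Qcoarse L)^[k] Y (z − e_κ) κ)‖²` ⟹
   `Σ_{x∈periodBox(L^k·N)} Σ_κ ‖Y x κ‖² ≤ (5 + 4d·Λ)·(L^k)²·Σ_x Σ_κ Σ_μ ‖Y(x+e_μ) κ − Y x κ‖²`;
§3 **`sum_norm_sq_le_of_iterate_Tcoarse_eq_zero`** (`(Tcoarse L)^[k] Y = 0`: constant `5 + 2d·N²`, k-FREE, N-dependent) and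
   **`sum_norm_sq_le_of_iterate_Qcoarse_eq_zero`** (`(Qcoarse L)^[k] Y = 0`: constant `5`, N-FREE).

HONEST FRAMING.  Kinematics of the LINEARISED average at the FLAT configuration; the constant is k-free and L-free but carries `N²`
(torus size in `L^k`-blocks) on the single-bar tangent space `ker d(avgIter k)(1)` — the SHAPE note §1 explains why an N-free constant
is not claimed there (the frame potential is rough; heuristic √k obstruction at d = 4) and that it holds on `ker (Qcoarse L)^[k]`;
nothing about Bałaban's minimisers, (ML_w), T-E_w or NE3 is asserted; NE3 NOT proved; spine 0∕9; finite T⁴ rung (B)+1 — NOT infinite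
volume, NOT mass gap, NOT BetaPertH, NOT Clay.  ABSOLUTE RULE kept (context: [Balaban1985PropagatorsII] Thm 3.3 (3.46) p.397,
[Balaban1984PropagatorsII] (2.153) p.249 — η-weighted coercivity statements; nothing printed is a hypothesis).  PLACEMENT:
`Summits/QuantumFields/BalabanUV/`.
-/

set_option autoImplicit false

open scoped BigOperators Matrix.Norms.L2Operator
open Finset

namespace Summit.QuantumFields.BalabanUV.T4Continuum.NE3BlockPoincareCore

open Literature.MathematicalPhysics.QuantumFieldTheory.Balaban1983to89
open B7Prop1Explicit
open T4AveragingDeficitWall (dirSq)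
open T4AveragingDeficitWallBoundary (periodBox mem_periodBox card_periodBox sum_periodBox_shift)
open AveragingDeficitPeriodicCounting (IsPeriodicDir)
open AveragingDeficitMultiLevelPrep (TangentIter)
open BlockAveragePushDirSplit (flat)
open SmoothRefineNeutral (Tcoarse)
open NE3TangentNoGoWords (dPot)
open NE3TangentFlatStructure (Qcoarse framePot iterate_Tcoarse_eq_zero_iff framePot_add_period
  iterate_Tcoarse_eq_zero_of_tangentIter iterate_Tcoarse_entry_eq_zero)
open NE3BlockLineAverage (iterate_Qcoarse_apply sum_periodBox_blocks norm_lineMean_sub_blockMean_sq_le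
  norm_lineMean_sub_shift_sq_le)
open NE3CoarseTorusExact (sum_norm_sub_blockMean_sq_le sum_sq_dPot_le_of_periodic)
open MatrixNorms (nhsNormSq card_mul_nhsNormSq opNorm_sq_le_card_mul_nhsNormSq nhsNormSq_le_opNorm_sq)

noncomputable section

variable {d : ℕ}

/-! ## §1 Bookkeeping -/

/-- `‖a‖² ≤ 2‖a − b‖² + 2‖b‖²`. [folklore] -/
theorem norm_sq_le_two_mul {E : Type*} [SeminormedAddCommGroup E] (a b : E) :
    ‖a‖ ^ 2 ≤ 2 * ‖a - b‖ ^ 2 + 2 * ‖b‖ ^ 2 := by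
  have h : ‖a‖ ≤ ‖a - b‖ + ‖b‖ := by
    have := norm_add_le (a - b) b
    rwa [sub_add_cancel] at this
  have h2 : ‖a‖ ^ 2 ≤ (‖a - b‖ + ‖b‖) ^ 2 := pow_le_pow_left₀ (norm_nonneg _) h 2
  nlinarith [h2, sq_nonneg (‖a - b‖ - ‖b‖)]

/-- Summed over a finite set against a fixed `m`: `Σ_v‖f v‖² ≤ 2Σ_v‖f v − m‖² + 2·#B·‖m‖²`. [folklore] -/
theorem sum_norm_sq_le_of_mean {E : Type*} [SeminormedAddCommGroup E] {ι : Type*} (B : Finset ι) (f : ι → E) (m : E) :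
    ∑ v ∈ B, ‖f v‖ ^ 2 ≤ 2 * ∑ v ∈ B, ‖f v - m‖ ^ 2 + 2 * B.card * ‖m‖ ^ 2 := by
  calc ∑ v ∈ B, ‖f v‖ ^ 2 ≤ ∑ v ∈ B, (2 * ‖f v - m‖ ^ 2 + 2 * ‖m‖ ^ 2) :=
        Finset.sum_le_sum fun v _ => norm_sq_le_two_mul (f v) m
    _ = 2 * ∑ v ∈ B, ‖f v - m‖ ^ 2 + 2 * B.card * ‖m‖ ^ 2 := by
        rw [Finset.sum_add_distrib, Finset.sum_const, nsmul_eq_mul, Finset.mul_sum]; ring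

/-- `(Σ_{κ} ‖a κ‖)`-type Cauchy–Schwarz: `‖Σ_κ a κ‖² ≤ d·Σ_κ ‖a κ‖²` over `Fin d`. [folklore] -/
theorem norm_sum_sq_le_card_mul {E : Type*} [SeminormedAddCommGroup E] (a : Fin d → E) :
    ‖∑ κ : Fin d, a κ‖ ^ 2 ≤ d * ∑ κ : Fin d, ‖a κ‖ ^ 2 := by
  have h1 : ‖∑ κ : Fin d, a κ‖ ^ 2 ≤ (∑ κ : Fin d, ‖a κ‖) ^ 2 :=
    pow_le_pow_left₀ (norm_nonneg _) (norm_sum_le _ _) 2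
  have h2 := sq_sum_le_card_mul_sum_sq (s := (Finset.univ : Finset (Fin d))) (f := fun κ => ‖a κ‖)
  rw [Finset.card_univ, Fintype.card_fin] at h2
  exact h1.trans h2

/-- Reordering: `Σ_a Σ_b Σ_c f = Σ_c Σ_a Σ_b f`. [folklore] -/
theorem sum_rotate3 {β : Type*} [AddCommMonoid β] {α₁ α₂ α₃ : Type*} (A : Finset α₁) (B : Finset α₂) (C : Finset α₃)
    (f : α₁ → α₂ → α₃ → β) :
    ∑ a ∈ A, ∑ b ∈ B, ∑ c ∈ C, f a b c = ∑ c ∈ C, ∑ a ∈ A, ∑ b ∈ B, f a b c := by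
  have h : ∀ a, ∑ b ∈ B, ∑ c ∈ C, f a b c = ∑ c ∈ C, ∑ b ∈ B, f a b c := fun a => Finset.sum_comm
  simp_rw [h]
  exact Finset.sum_comm

/-- Reordering: `Σ_a Σ_b Σ_c Σ_e f = Σ_c Σ_e Σ_a Σ_b f`. [folklore] -/
theorem sum_rotate4 {β : Type*} [AddCommMonoid β] {α₁ α₂ α₃ α₄ : Type*} (A : Finset α₁) (B : Finset α₂)
    (C : Finset α₃) (D : Finset α₄) (f : α₁ → α₂ → α₃ → α₄ → β) :
    ∑ a ∈ A, ∑ b ∈ B, ∑ c ∈ C, ∑ e ∈ D, f a b c e = ∑ c ∈ C, ∑ e ∈ D, ∑ a ∈ A, ∑ b ∈ B, f a b c e := by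
  rw [sum_rotate3 A B C (fun a b c => ∑ e ∈ D, f a b c e)]
  refine Finset.sum_congr rfl fun c _ => ?_
  exact sum_rotate3 A B D (fun a b e => f a b c e)

/-- Reordering: `Σ_a Σ_b Σ_c f = Σ_b Σ_c Σ_a f` (outermost to innermost). [folklore] -/
theorem sum_rotate3' {β : Type*} [AddCommMonoid β] {α₁ α₂ α₃ : Type*} (A : Finset α₁) (B : Finset α₂) (C : Finset α₃)
    (f : α₁ → α₂ → α₃ → β) :
    ∑ a ∈ A, ∑ b ∈ B, ∑ c ∈ C, f a b c = ∑ b ∈ B, ∑ c ∈ C, ∑ a ∈ A, f a b c := by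
  rw [Finset.sum_comm]
  exact Finset.sum_congr rfl fun b _ => Finset.sum_comm

/-- Reordering: `Σ_a Σ_b Σ_c Σ_e f = Σ_b Σ_c Σ_e Σ_a f` (outermost to innermost). [folklore] -/
theorem sum_rotate4' {β : Type*} [AddCommMonoid β] {α₁ α₂ α₃ α₄ : Type*} (A : Finset α₁) (B : Finset α₂)
    (C : Finset α₃) (D : Finset α₄) (f : α₁ → α₂ → α₃ → α₄ → β) :
    ∑ a ∈ A, ∑ b ∈ B, ∑ c ∈ C, ∑ e ∈ D, f a b c e = ∑ b ∈ B, ∑ c ∈ C, ∑ e ∈ D, ∑ a ∈ A, f a b c e := by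
  rw [Finset.sum_comm]
  exact Finset.sum_congr rfl fun b _ => sum_rotate3' A C D (fun a c e => f a b c e)

/-- Block-by-block summation of the torus: `Σ_{z∈[0,N)^d} Σ_{v∈[0,M)^d} g(M•z + v) = Σ_{x∈[0,MN)^d} g x`. [folklore] -/
theorem sum_blocks_torus {β : Type*} [AddCommMonoid β] {M : ℕ} (hM : 1 ≤ M) (N : ℕ) (g : Site d → β) :
    ∑ z ∈ periodBox (d := d) N, ∑ v ∈ periodBox (d := d) M, g ((M : ℤ) • z + v) = ∑ x ∈ periodBox (d := d) (M * N), g x :=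
  sum_periodBox_blocks M N hM g

/-- … followed by a periodic shift: `Σ_z Σ_v g(M•z + v + w) = Σ_x g x` for `(MN)`-periodic real `g`. [folklore] -/
theorem sum_blocks_torus_shift {M N : ℕ} (hM : 1 ≤ M) (hN : 1 ≤ N) {g : Site d → ℝ}
    (hg : ∀ (x : Site d) (τ : Fin d), g (x + ((M * N : ℕ) : ℤ) • e τ) = g x) (w : Site d) :
    ∑ z ∈ periodBox (d := d) N, ∑ v ∈ periodBox (d := d) M, g ((M : ℤ) • z + v + w) = ∑ x ∈ periodBox (d := d) (M * N), g x := by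
  rw [sum_blocks_torus hM N (fun x => g (x + w))]
  exact sum_periodBox_shift (M * N) (Nat.one_le_iff_ne_zero.mpr (Nat.mul_ne_zero (by omega) (by omega))) hg w

/-! ## §2 The core: from a bound on the line mean by its coarse divergence to the Poincaré inequality -/

/-- **THE CORE OF THE BLOCK-POINCARÉ INEQUALITY** (complex values).  Let `L ≥ 1`, `N ≥ 1`, `M = L^k`, `Y` an `(M·N)`-periodic
complex 1-cochain, and suppose the k-fold STRAIGHT average `S = (Qcoarse L)^[k] Y` (read on the coarse `N`-torus) satisfies
`Σ_{z,κ}‖S z κ‖² ≤ Λ·Σ_z ‖Σ_κ (S z κ − S (z − e_κ) κ)‖²` for some `Λ ≥ 0`.  Then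
`Σ_{x∈periodBox(M·N)} Σ_κ ‖Y x κ‖² ≤ (5 + 4d·Λ)·M²·Σ_{x∈periodBox(M·N)} Σ_κ Σ_μ ‖Y(x+e_μ) κ − Y x κ‖²`. [folklore] -/
theorem sum_norm_sq_le_of_lineMean_bound {L : ℕ} (hL : 1 ≤ L) {N : ℕ} (hN : 1 ≤ N) (k : ℕ) (Y : Site d → Fin d → ℂ)
    (hY : ∀ (x : Site d) (τ μ : Fin d), Y (x + ((L ^ k * N : ℕ) : ℤ) • e τ) μ = Y x μ) {Λ : ℝ} (hΛ : 0 ≤ Λ)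
    (hS : ∑ z ∈ periodBox (d := d) N, ∑ κ : Fin d, ‖(Qcoarse L)^[k] Y z κ‖ ^ 2
      ≤ Λ * ∑ z ∈ periodBox (d := d) N, ‖∑ κ : Fin d, ((Qcoarse L)^[k] Y z κ - (Qcoarse L)^[k] Y (z - e κ) κ)‖ ^ 2) :
    ∑ x ∈ periodBox (d := d) (L ^ k * N), ∑ κ : Fin d, ‖Y x κ‖ ^ 2
      ≤ (5 + 4 * d * Λ) * ((L : ℝ) ^ k) ^ 2
          * ∑ x ∈ periodBox (d := d) (L ^ k * N), ∑ κ : Fin d, ∑ μ : Fin d, ‖Y (x + e μ) κ - Y x κ‖ ^ 2 := by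
  -- notation
  set M : ℕ := L ^ k with hMdef
  have hM : 1 ≤ M := Nat.one_le_pow _ _ hL
  have hM0 : (0 : ℝ) < M := by exact_mod_cast (by omega : 0 < M)
  have hMR : ((L : ℝ) ^ k) = (M : ℝ) := by rw [hMdef]; push_cast; ring
  set B : Finset (Site d) := periodBox (d := d) M with hBdef
  have hcardB : (B.card : ℝ) = (M : ℝ) ^ d := by rw [hBdef, card_periodBox]; push_cast; ring
  -- the gradient density per component and the full gradient
  set g : Fin d → Site d → ℝ := fun κ x => ‖Y (x + e κ) κ - Y x κ‖ ^ 2 with hgdef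
  set G : ℝ := ∑ x ∈ periodBox (d := d) (M * N), ∑ κ : Fin d, ∑ μ : Fin d, ‖Y (x + e μ) κ - Y x κ‖ ^ 2 with hGdef
  have hG0 : 0 ≤ G := by positivity
  have hgper : ∀ (κ : Fin d) (x : Site d) (τ : Fin d), g κ (x + ((M * N : ℕ) : ℤ) • e τ) = g κ x := by
    intro κ x τ
    simp only [hgdef]
    rw [add_right_comm, hY, hY]
  have hdiag : ∑ κ : Fin d, ∑ x ∈ periodBox (d := d) (M * N), g κ x ≤ G := by
    rw [hGdef, Finset.sum_comm]
    refine Finset.sum_le_sum fun x _ => Finset.sum_le_sum fun κ _ => ?_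
    exact Finset.single_le_sum (f := fun μ => ‖Y (x + e μ) κ - Y x κ‖ ^ 2) (fun _ _ => sq_nonneg _) (Finset.mem_univ κ)
  -- the line sum `T z κ = Σ_v Σ_i Y(M•z + v + i e_κ, κ)` and the tiling `S = (M^d)⁻¹ • T`
  set T : Site d → Fin d → ℂ := fun z κ => ∑ v ∈ B, ∑ i ∈ range M, Y ((M : ℤ) • z + v + (i : ℤ) • e κ) κ with hTdef
  have htil : ∀ (z : Site d) (κ : Fin d), (Qcoarse L)^[k] Y z κ = (((M : ℝ) ^ d)⁻¹ : ℝ) • T z κ := by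
    intro z κ
    exact iterate_Qcoarse_apply hL k Y z κ
  -- transfer the hypothesis to the unnormalised line sums
  set c : ℝ := (((M : ℝ) ^ d)⁻¹ : ℝ) with hcdef
  have hc0 : 0 < c := by rw [hcdef]; positivity
  have hS' : ∑ z ∈ periodBox (d := d) N, ∑ κ : Fin d, ‖T z κ‖ ^ 2
      ≤ Λ * ∑ z ∈ periodBox (d := d) N, ‖∑ κ : Fin d, (T z κ - T (z - e κ) κ)‖ ^ 2 := by
    have h1 : ∑ z ∈ periodBox (d := d) N, ∑ κ : Fin d, ‖(Qcoarse L)^[k] Y z κ‖ ^ 2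
        = c ^ 2 * ∑ z ∈ periodBox (d := d) N, ∑ κ : Fin d, ‖T z κ‖ ^ 2 := by
      rw [Finset.mul_sum]
      refine Finset.sum_congr rfl fun z _ => ?_
      rw [Finset.mul_sum]
      refine Finset.sum_congr rfl fun κ _ => ?_
      simp only [htil, norm_smul, Real.norm_eq_abs, abs_of_pos hc0, mul_pow]
    have h2 : ∑ z ∈ periodBox (d := d) N, ‖∑ κ : Fin d, ((Qcoarse L)^[k] Y z κ - (Qcoarse L)^[k] Y (z - e κ) κ)‖ ^ 2
        = c ^ 2 * ∑ z ∈ periodBox (d := d) N, ‖∑ κ : Fin d, (T z κ - T (z - e κ) κ)‖ ^ 2 := by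
      rw [Finset.mul_sum]
      refine Finset.sum_congr rfl fun z _ => ?_
      have : ∑ κ : Fin d, ((Qcoarse L)^[k] Y z κ - (Qcoarse L)^[k] Y (z - e κ) κ) = c • ∑ κ : Fin d, (T z κ - T (z - e κ) κ) := by
        rw [Finset.smul_sum]
        refine Finset.sum_congr rfl fun κ _ => ?_
        rw [htil, htil, smul_sub]
      simp only [this, norm_smul, Real.norm_eq_abs, abs_of_pos hc0, mul_pow]
    rw [h1, h2, ← mul_assoc, mul_comm Λ (c ^ 2), mul_assoc] at hS
    exact le_of_mul_le_mul_left hS (by positivity)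
  -- (1) per block and component: oscillation + mean
  have hblock : ∀ (z : Site d) (κ : Fin d),
      (M : ℝ) ^ 2 * (M : ℝ) ^ d * ∑ v ∈ B, ‖Y ((M : ℤ) • z + v) κ‖ ^ 2
        ≤ (M : ℝ) ^ 2 * (M : ℝ) ^ d * ((M : ℝ) ^ 2 * ∑ v ∈ B, ∑ μ : Fin d, ‖Y ((M : ℤ) • z + v + e μ) κ - Y ((M : ℤ) • z + v) κ‖ ^ 2)
          + 4 * ((M : ℝ) ^ 2 * ((M : ℝ) ^ d * M)
              * ∑ v ∈ B, ∑ j ∈ range M, ‖Y ((M : ℤ) • z + v + ((j : ℤ) + 1) • e κ) κ - Y ((M : ℤ) • z + v + (j : ℤ) • e κ) κ‖ ^ 2)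
          + 4 * ‖T z κ‖ ^ 2 := by
    intro z κ
    set q : Site d := (M : ℤ) • z with hq
    set A : ℂ := ∑ v ∈ B, Y (q + v) κ with hA
    -- oscillation (C1) and the abstract mean split
    have hosc := sum_norm_sub_blockMean_sq_le hM (fun x => Y x κ) q
    have hmean := sum_norm_sq_le_of_mean B (fun v => Y (q + v) κ) (A / ((M : ℂ) ^ d))
    have hnormm : (B.card : ℝ) * ‖A / ((M : ℂ) ^ d)‖ ^ 2 = ‖A‖ ^ 2 / (M : ℝ) ^ d := by
      rw [norm_div, norm_pow, Complex.norm_natCast, hcardB, div_pow]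
      field_simp
    -- the mean against the line sum (B)
    have hline := norm_lineMean_sub_blockMean_sq_le Y q κ B M
    have hA2 : (M : ℝ) ^ 2 * ‖A‖ ^ 2 ≤ 2 * ‖T z κ - (M : ℝ) • A‖ ^ 2 + 2 * ‖T z κ‖ ^ 2 := by
      have h := norm_sq_le_two_mul ((M : ℝ) • A) (T z κ)
      rw [norm_smul, Real.norm_eq_abs, abs_of_pos hM0, mul_pow, norm_sub_rev] at h
      exact h
    have hTA : ‖T z κ - (M : ℝ) • A‖ ^ 2
        ≤ (M : ℝ) ^ 2 * (B.card * M)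
            * ∑ v ∈ B, ∑ j ∈ range M, ‖Y (q + v + ((j : ℤ) + 1) • e κ) κ - Y (q + v + (j : ℤ) • e κ) κ‖ ^ 2 := by
      simpa only [hTdef, hA] using hline
    rw [hcardB] at hTA
    -- assemble
    have hMd0 : (0 : ℝ) < (M : ℝ) ^ d := by positivity
    have step1 : (M : ℝ) ^ 2 * (M : ℝ) ^ d * ∑ v ∈ B, ‖Y (q + v) κ‖ ^ 2
        ≤ (M : ℝ) ^ 2 * (M : ℝ) ^ d * (2 * ∑ v ∈ B, ‖Y (q + v) κ - A / ((M : ℂ) ^ d)‖ ^ 2) + 2 * ((M : ℝ) ^ 2 * ‖A‖ ^ 2) := by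
      have := mul_le_mul_of_nonneg_left hmean (le_of_lt (mul_pos (pow_pos hM0 2) hMd0))
      refine this.trans (le_of_eq ?_)
      rw [mul_add, mul_assoc (2 : ℝ) (B.card : ℝ), hnormm]
      field_simp
    have step2 : (M : ℝ) ^ 2 * (M : ℝ) ^ d * (2 * ∑ v ∈ B, ‖Y (q + v) κ - A / ((M : ℂ) ^ d)‖ ^ 2)
        ≤ (M : ℝ) ^ 2 * (M : ℝ) ^ d * ((M : ℝ) ^ 2 * ∑ v ∈ B, ∑ μ : Fin d, ‖Y (q + v + e μ) κ - Y (q + v) κ‖ ^ 2) := by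
      refine mul_le_mul_of_nonneg_left ?_ (le_of_lt (mul_pos (pow_pos hM0 2) hMd0))
      linarith [hosc]
    nlinarith [step1, step2, hA2, hTA, norm_nonneg (T z κ)]
  -- (2) sum over blocks and components
  have hsumY : ∑ z ∈ periodBox (d := d) N, ∑ κ : Fin d, ∑ v ∈ B, ‖Y ((M : ℤ) • z + v) κ‖ ^ 2
      = ∑ x ∈ periodBox (d := d) (M * N), ∑ κ : Fin d, ‖Y x κ‖ ^ 2 := by
    rw [← sum_blocks_torus hM N (fun x => ∑ κ : Fin d, ‖Y x κ‖ ^ 2)]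
    exact Finset.sum_congr rfl fun z _ => Finset.sum_comm
  have hsumOsc : ∑ z ∈ periodBox (d := d) N, ∑ κ : Fin d,
        ∑ v ∈ B, ∑ μ : Fin d, ‖Y ((M : ℤ) • z + v + e μ) κ - Y ((M : ℤ) • z + v) κ‖ ^ 2 = G := by
    rw [hGdef, ← sum_blocks_torus hM N (fun x => ∑ κ : Fin d, ∑ μ : Fin d, ‖Y (x + e μ) κ - Y x κ‖ ^ 2)]
    exact Finset.sum_congr rfl fun z _ => Finset.sum_comm
  have hsumSeg : ∑ z ∈ periodBox (d := d) N, ∑ κ : Fin d,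
        ∑ v ∈ B, ∑ j ∈ range M, ‖Y ((M : ℤ) • z + v + ((j : ℤ) + 1) • e κ) κ - Y ((M : ℤ) • z + v + (j : ℤ) • e κ) κ‖ ^ 2
      ≤ M * G := by
    calc ∑ z ∈ periodBox (d := d) N, ∑ κ : Fin d,
          ∑ v ∈ B, ∑ j ∈ range M, ‖Y ((M : ℤ) • z + v + ((j : ℤ) + 1) • e κ) κ - Y ((M : ℤ) • z + v + (j : ℤ) • e κ) κ‖ ^ 2
        = ∑ κ : Fin d, ∑ z ∈ periodBox (d := d) N, ∑ v ∈ B, ∑ j ∈ range M, g κ ((M : ℤ) • z + v + (j : ℤ) • e κ) := by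
          rw [Finset.sum_comm]
          refine Finset.sum_congr rfl fun κ _ => Finset.sum_congr rfl fun z _ => Finset.sum_congr rfl fun v _ =>
            Finset.sum_congr rfl fun j _ => ?_
          simp only [hgdef, add_one_zsmul, add_assoc]
      _ = ∑ κ : Fin d, ∑ j ∈ range M, ∑ z ∈ periodBox (d := d) N, ∑ v ∈ B, g κ ((M : ℤ) • z + v + (j : ℤ) • e κ) :=
          Finset.sum_congr rfl fun κ _ => sum_rotate3 _ _ _ _
      _ = ∑ κ : Fin d, ∑ _j ∈ range M, ∑ x ∈ periodBox (d := d) (M * N), g κ x := by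
          refine Finset.sum_congr rfl fun κ _ => Finset.sum_congr rfl fun j _ => ?_
          exact sum_blocks_torus_shift hM hN (hgper κ) _
      _ = M * ∑ κ : Fin d, ∑ x ∈ periodBox (d := d) (M * N), g κ x := by
          rw [Finset.mul_sum]
          refine Finset.sum_congr rfl fun κ _ => ?_
          rw [Finset.sum_const, card_range, nsmul_eq_mul]
      _ ≤ M * G := mul_le_mul_of_nonneg_left hdiag (Nat.cast_nonneg M)
  -- (3) the line sums: bounded by the coarse divergence, which telescopes to gradients
  have hdivT : ∀ z : Site d, ‖∑ κ : Fin d, (T z κ - T (z - e κ) κ)‖ ^ 2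
      ≤ d * (((M : ℝ) ^ d * M * M) * ∑ κ : Fin d, ∑ v ∈ B, ∑ i ∈ range M, ∑ j ∈ range M,
          g κ ((M : ℤ) • z + v + (i : ℤ) • e κ - (M : ℤ) • e κ + (j : ℤ) • e κ)) := by
    intro z
    refine (norm_sum_sq_le_card_mul _).trans ?_
    refine mul_le_mul_of_nonneg_left ?_ (Nat.cast_nonneg d)
    rw [Finset.mul_sum]
    refine Finset.sum_le_sum fun κ _ => ?_
    have h := norm_lineMean_sub_shift_sq_le Y ((M : ℤ) • z) κ B M
    rw [hcardB] at h
    have hcorner : (M : ℤ) • (z - e κ) = (M : ℤ) • z - (M : ℤ) • e κ := smul_sub _ _ _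
    have hT1 : T z κ = ∑ v ∈ B, ∑ i ∈ range M, Y ((M : ℤ) • z + v + (i : ℤ) • e κ) κ := rfl
    have hT2 : T (z - e κ) κ = ∑ v ∈ B, ∑ i ∈ range M, Y ((M : ℤ) • z - (M : ℤ) • e κ + v + (i : ℤ) • e κ) κ := by
      simp only [hTdef, hcorner]
    rw [hT1, hT2]
    refine h.trans (le_of_eq ?_)
    congr 1
    refine Finset.sum_congr rfl fun v _ => Finset.sum_congr rfl fun i _ => Finset.sum_congr rfl fun j _ => ?_
    simp only [hgdef, add_one_zsmul, add_assoc]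
  have hsumT : ∑ z ∈ periodBox (d := d) N, ∑ κ : Fin d, ‖T z κ‖ ^ 2 ≤ Λ * (d * ((M : ℝ) ^ d * M * M * (M * M)) * G) := by
    refine hS'.trans (mul_le_mul_of_nonneg_left ?_ hΛ)
    calc ∑ z ∈ periodBox (d := d) N, ‖∑ κ : Fin d, (T z κ - T (z - e κ) κ)‖ ^ 2
        ≤ ∑ z ∈ periodBox (d := d) N, d * (((M : ℝ) ^ d * M * M) * ∑ κ : Fin d, ∑ v ∈ B, ∑ i ∈ range M, ∑ j ∈ range M,
            g κ ((M : ℤ) • z + v + (i : ℤ) • e κ - (M : ℤ) • e κ + (j : ℤ) • e κ)) := Finset.sum_le_sum fun z _ => hdivT z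
      _ = d * (((M : ℝ) ^ d * M * M) * ∑ z ∈ periodBox (d := d) N, ∑ κ : Fin d, ∑ v ∈ B, ∑ i ∈ range M, ∑ j ∈ range M,
            g κ ((M : ℤ) • z + v + (i : ℤ) • e κ - (M : ℤ) • e κ + (j : ℤ) • e κ)) := by
          rw [← Finset.mul_sum, ← Finset.mul_sum]
      _ = d * (((M : ℝ) ^ d * M * M) * ∑ κ : Fin d, ∑ i ∈ range M, ∑ j ∈ range M,
            ∑ z ∈ periodBox (d := d) N, ∑ v ∈ B, g κ ((M : ℤ) • z + v + ((i : ℤ) • e κ - (M : ℤ) • e κ + (j : ℤ) • e κ))) := by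
          congr 2
          rw [Finset.sum_comm]
          refine Finset.sum_congr rfl fun κ _ => ?_
          rw [sum_rotate4]
          refine Finset.sum_congr rfl fun i _ => Finset.sum_congr rfl fun j _ => Finset.sum_congr rfl fun z _ =>
            Finset.sum_congr rfl fun v _ => ?_
          congr 1
          abel
      _ = d * (((M : ℝ) ^ d * M * M) * ∑ κ : Fin d, ∑ _i ∈ range M, ∑ _j ∈ range M,
            ∑ x ∈ periodBox (d := d) (M * N), g κ x) := by
          congr 2
          refine Finset.sum_congr rfl fun κ _ => Finset.sum_congr rfl fun i _ => Finset.sum_congr rfl fun j _ => ?_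
          exact sum_blocks_torus_shift hM hN (hgper κ) _
      _ = d * (((M : ℝ) ^ d * M * M) * ∑ κ : Fin d, ((M : ℝ) * M * ∑ x ∈ periodBox (d := d) (M * N), g κ x)) := by
          congr 2
          refine Finset.sum_congr rfl fun κ _ => ?_
          rw [Finset.sum_const, card_range, Finset.sum_const, card_range, smul_smul, nsmul_eq_mul]
          push_cast; ring
      _ = d * ((M : ℝ) ^ d * M * M * (M * M)) * ∑ κ : Fin d, ∑ x ∈ periodBox (d := d) (M * N), g κ x := by
          rw [← Finset.mul_sum]; ring
      _ ≤ d * ((M : ℝ) ^ d * M * M * (M * M)) * G := mul_le_mul_of_nonneg_left hdiag (by positivity)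
  -- (4) conclude
  have hfinal : (M : ℝ) ^ 2 * (M : ℝ) ^ d * ∑ x ∈ periodBox (d := d) (M * N), ∑ κ : Fin d, ‖Y x κ‖ ^ 2
      ≤ (M : ℝ) ^ 2 * (M : ℝ) ^ d * ((5 + 4 * d * Λ) * (M : ℝ) ^ 2 * G) := by
    have hsum := Finset.sum_le_sum fun z (_ : z ∈ periodBox (d := d) N) =>
      Finset.sum_le_sum fun κ (_ : κ ∈ (Finset.univ : Finset (Fin d))) => hblock z κ
    rw [← hsumY]
    simp only [Finset.sum_add_distrib, ← Finset.mul_sum] at hsum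
    refine hsum.trans ?_
    rw [hsumOsc]
    have hMd0 : (0 : ℝ) ≤ (M : ℝ) ^ d := by positivity
    have e1 : 4 * ((M : ℝ) ^ 2 * ((M : ℝ) ^ d * M) * ∑ z ∈ periodBox (d := d) N, ∑ κ : Fin d,
          ∑ v ∈ B, ∑ j ∈ range M, ‖Y ((M : ℤ) • z + v + ((j : ℤ) + 1) • e κ) κ - Y ((M : ℤ) • z + v + (j : ℤ) • e κ) κ‖ ^ 2)
        ≤ 4 * ((M : ℝ) ^ 2 * ((M : ℝ) ^ d * M) * (M * G)) :=
      mul_le_mul_of_nonneg_left (mul_le_mul_of_nonneg_left hsumSeg (by positivity)) (by norm_num)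
    have e2 : 4 * ∑ z ∈ periodBox (d := d) N, ∑ κ : Fin d, ‖T z κ‖ ^ 2 ≤ 4 * (Λ * (d * ((M : ℝ) ^ d * M * M * (M * M)) * G)) :=
      mul_le_mul_of_nonneg_left hsumT (by norm_num)
    have e3 : (M : ℝ) ^ 2 * (M : ℝ) ^ d * ((M : ℝ) ^ 2 * G) + 4 * ((M : ℝ) ^ 2 * ((M : ℝ) ^ d * M) * (M * G))
        + 4 * (Λ * (d * ((M : ℝ) ^ d * M * M * (M * M)) * G))
        = (M : ℝ) ^ 2 * (M : ℝ) ^ d * ((5 + 4 * d * Λ) * (M : ℝ) ^ 2 * G) := by ring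
    linarith [e1, e2, e3]
  have hpos : (0 : ℝ) < (M : ℝ) ^ 2 * (M : ℝ) ^ d := by positivity
  rw [hMR, show (L ^ k * N : ℕ) = M * N from rfl]
  exact le_of_mul_le_mul_left hfinal hpos

/-! ## §3 The two instances: the k-fold tangent space (`Λ = N²∕2`) and the straight kernel (`Λ = 0`) -/

/-- **BLOCK-POINCARÉ ON THE KERNEL OF THE k-FOLD CONTOUR AVERAGE** (complex values): `L ≥ 1`, `N ≥ 1`, `Y` an
`(L^k·N)`-periodic complex 1-cochain with `(Tcoarse L)^[k] Y = 0`.  Then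
`Σ_x Σ_κ ‖Y x κ‖² ≤ (5 + 2d·N²)·(L^k)²·Σ_x Σ_κ Σ_μ ‖Y(x+e_μ) κ − Y x κ‖²` over `periodBox (L^k·N)` — k-FREE, L-free, N-dependent
(frames coarse-exact (A) + exact 1-forms bounded by their divergence with constant `N²∕2` (C1)). [folklore] -/
theorem sum_norm_sq_le_of_iterate_Tcoarse_eq_zero {L : ℕ} (hL : 1 ≤ L) {N : ℕ} (hN : 1 ≤ N) (k : ℕ)
    (Y : Site d → Fin d → ℂ) (hY : ∀ (x : Site d) (τ μ : Fin d), Y (x + ((L ^ k * N : ℕ) : ℤ) • e τ) μ = Y x μ)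
    (hT : (Tcoarse L)^[k] Y = 0) :
    ∑ x ∈ periodBox (d := d) (L ^ k * N), ∑ κ : Fin d, ‖Y x κ‖ ^ 2
      ≤ (5 + 2 * d * (N : ℝ) ^ 2) * ((L : ℝ) ^ k) ^ 2
          * ∑ x ∈ periodBox (d := d) (L ^ k * N), ∑ κ : Fin d, ∑ μ : Fin d, ‖Y (x + e μ) κ - Y x κ‖ ^ 2 := by
  -- the straight average is the coboundary of the (periodic) frame potential
  have hQ : (Qcoarse L)^[k] Y = dPot (framePot L k Y) := (iterate_Tcoarse_eq_zero_iff hL k Y).mp hT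
  have hY' : ∀ (y : Site d) (τ μ : Fin d), Y (y + ((L : ℤ) ^ k * N) • e τ) μ = Y y μ := by
    intro y τ μ
    have := hY y τ μ
    push_cast at this
    exact this
  have hGper : ∀ (z : Site d) (τ : Fin d), framePot L k Y (z + (N : ℤ) • e τ) = framePot L k Y z :=
    framePot_add_period L k Y hY'
  have hex := sum_sq_dPot_le_of_periodic (d := d) hN hGper
  rw [← hQ] at hex
  have h := sum_norm_sq_le_of_lineMean_bound hL hN k Y hY (Λ := (N : ℝ) ^ 2 / 2) (by positivity) hex
  refine h.trans (le_of_eq ?_)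
  ring

/-- **BLOCK-POINCARÉ ON THE KERNEL OF THE STRAIGHT k-BLOCK AVERAGE, N-FREE** (complex values): if `(Qcoarse L)^[k] Y = 0` then
`Σ_x Σ_κ ‖Y x κ‖² ≤ 5·(L^k)²·Σ_x Σ_κ Σ_μ ‖Y(x+e_μ) κ − Y x κ‖²` over `periodBox (L^k·N)` — the frames-removed (double-bar) tangent
space carries the Poincaré inequality WITHOUT the torus factor. [folklore] -/
theorem sum_norm_sq_le_of_iterate_Qcoarse_eq_zero {L : ℕ} (hL : 1 ≤ L) {N : ℕ} (hN : 1 ≤ N) (k : ℕ)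
    (Y : Site d → Fin d → ℂ) (hY : ∀ (x : Site d) (τ μ : Fin d), Y (x + ((L ^ k * N : ℕ) : ℤ) • e τ) μ = Y x μ)
    (hQ : (Qcoarse L)^[k] Y = 0) :
    ∑ x ∈ periodBox (d := d) (L ^ k * N), ∑ κ : Fin d, ‖Y x κ‖ ^ 2
      ≤ 5 * ((L : ℝ) ^ k) ^ 2 * ∑ x ∈ periodBox (d := d) (L ^ k * N), ∑ κ : Fin d, ∑ μ : Fin d, ‖Y (x + e μ) κ - Y x κ‖ ^ 2 := by
  have hS : ∑ z ∈ periodBox (d := d) N, ∑ κ : Fin d, ‖(Qcoarse L)^[k] Y z κ‖ ^ 2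
      ≤ 0 * ∑ z ∈ periodBox (d := d) N, ‖∑ κ : Fin d, ((Qcoarse L)^[k] Y z κ - (Qcoarse L)^[k] Y (z - e κ) κ)‖ ^ 2 := by
    rw [hQ]; simp
  have h := sum_norm_sq_le_of_lineMean_bound hL hN k Y hY (Λ := 0) le_rfl hS
  refine h.trans (le_of_eq ?_)
  ring

end

end Summit.QuantumFields.BalabanUV.T4Continuum.NE3BlockPoincareCore
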